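import Summits.Ventures.HodgeRepro2.Faces
import Summits.Ventures.HodgeRepro2.InducedTypeAssembly
import Summits.Ventures.HodgeRepro2.ReflexComplex
import Summits.Ventures.HodgeRepro2.TraceField
import Summits.Ventures.HodgeRepro2.T5AutExtension
import Summits.Ventures.HodgeRepro2.T6B4Interface

/-!
# T6B4Main — sub-goal B4 «the orientation / sign convention» in kernel (Tier 6, cell pub-hodge-repro2)

Owner t6-p7 (route/T6-B4-t6-p7.md). The record formalised: route/TIER4.md §B4 (= route/T4-B4-p1.md
v7): CLAIM (B4-I) = Prop. B4.3 (1)+(2), the B3 Application (i), Lemma B4.1's consequence and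
Lemma B4.2(i) in the form B4 consumes them.

* `B4_main` — Prop. B4.3(2) / CLAIM (B4-I): under the B3 interface (Eq) and (D)
  (`T6B4Interface.EqCompat`, `T6B4Interface.HodgeDictionary`) and `F₁ = τ₁(F) ⊆ M̃_μ`, the CM type
  `Φ̃(τ₁)` of `M̃_μ` is INDUCED from `(F₁, Φ_μ⁻¹)` — the `F`-type of `(A_μ ⊗_{τ₁} ℂ, ι)` is
  `r · Φ_μ⁻¹`, so that Liu's `A_{μ_i}` carries the brief's type `T_i` exactly when `Φ_{μ_i} = T_i⁻¹`
  (`B4_vertex`). The inversion is a computed consequence of (D) + (Eq), not a choice (README §6 item 2).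
* `mem_iff_of_extends` — Prop. B4.3(1): `θ ∈ Φ̃(τ₁) ⟺ g_θ⁻¹ ∘ τ₁ ∈ Φ_μ` for any `g_θ ∈ Aut(ℂ)` above
  `θ`; `exists_extension` — such a `g_θ` exists (Hungerford Thm. VI.1.12, E11 / row T13, in kernel
  through p1's `T5AutExtension.exists_ringEquiv_comp_eq`: NO displayed hypothesis is needed for it);
  `inverse_mem_iff_of_agree` — the right-hand side does not depend on the choice of `g_θ` once
  `M_μ ⊆ M̃_μ` (Lemma B4.1's consequence, via `mem_fixingSubgroup_complexTraceField_iff`).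
* `exists_factor_of_isPrimitiveOn`, `B4_primitive` — Lemma B4.2(i) + B3 Application (i): for a
  primitive vertex `M_μ = F₁`, hence `F₁ ⊆ M̃_μ` and `B4_main` applies.

Everything else of §B4 is already kernel-checked in the Tier-4 annex and is cited by name in the
owner file (Prop. B4.5 = CubeCoordinates / Orientation / SexticGalois; Lemma B4.4's linear algebra =
InducedTypeSplitting / InducedTypeAssembly; Remark B4.6 = FaceData; B4.7 = Orientation;
B4.8 = LocalSignRelabelling; Application (ii)'s transport = IsogenyTransport). What is NOT in
kernel (declared, not hidden): the passage from the lattice identity to complex tori / abelian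
varieties (Shimura 1998 Thm. 2 / Thm. 3 / Corollary, Lange §1.1.2 / Prop. 1.1.15), which needs the
abelian-variety carriers of the host-api package (TARGET-T6.md §6 R2) and is displayed by the §3
owners of those rows, and the proofs of (Eq) / (D) themselves (sub-goal B3).

Proof lane: 0 sorry; axioms ⊆ {propext, Classical.choice, Quot.sound}; Mathlib + own prefix only.
-/

namespace Summit.Ventures.HodgeRepro2.T6.B4Main

open Summit.Ventures.HodgeRepro2 Summit.Ventures.HodgeRepro2.T6.B4Interface
  Summit.Ventures.HodgeRepro2.T5AutExtension

variable {K : Type*} [Field K]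

/-- Every ring homomorphism from a number field `M ⊆ ℂ` into `ℂ` extends to an automorphism of `ℂ`
(Hungerford Thm. VI.1.12 in the case of TIER4 Prop. B4.3(1), E11 / row T13) — the instance of
p1's `T5AutExtension.exists_ringEquiv_comp_eq` with `σ₁` the inclusion of `M`. -/
theorem exists_extension (M : IntermediateField ℚ ℂ) [FiniteDimensional ℚ M] (θ : M →+* ℂ) :
    ∃ g : ℂ ≃+* ℂ, ∀ x : M, g x = θ x := by
  haveI : Countable M := countable_of_finiteDimensional ℚ M
  exact exists_ringEquiv_comp_eq (algebraMap M ℂ) θ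

/-- If `g ∈ Aut(ℂ)` extends `θ : M →+* ℂ` then `g⁻¹ ∘ θ` is the inclusion of `M`. -/
theorem symm_comp_eq_algebraMap {M : IntermediateField ℚ ℂ} {θ : M →+* ℂ} {g : ℂ ≃+* ℂ}
    (hg : ∀ x : M, g x = θ x) : (g.symm : ℂ →+* ℂ).comp θ = algebraMap M ℂ := by
  ext x
  simp only [RingHom.coe_comp, RingHom.coe_coe, Function.comp_apply, ← hg x,
    RingEquiv.symm_apply_apply]
  rfl

/-- **TIER4 Prop. B4.3(1), the displayed formula of (B4-I)**: under (Eq) and (D), for every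
`θ : M̃_μ →+* ℂ` and every `g ∈ Aut(ℂ)` extending `θ`,
`θ ∈ Φ̃(τ₁) ⟺ g⁻¹ ∘ τ₁ ∈ Φ_μ`. -/
theorem mem_iff_of_extends {M : IntermediateField ℚ ℂ} {Φμ : Set (K →+* ℂ)}
    {Φt : (K →+* ℂ) → Set (M →+* ℂ)} (hEq : EqCompat M Φt) (hD : HodgeDictionary M Φμ Φt)
    (τ₁ : K →+* ℂ) (θ : M →+* ℂ) (g : ℂ ≃+* ℂ) (hg : ∀ x : M, g x = θ x) :
    θ ∈ Φt τ₁ ↔ (g.symm : ℂ →+* ℂ).comp τ₁ ∈ Φμ := by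
  rw [← hD, hEq g.symm τ₁]
  have hθ := symm_comp_eq_algebraMap hg
  constructor
  · intro h
    exact ⟨θ, h, hθ⟩
  · rintro ⟨θ', hθ', h⟩
    have : θ' = θ := by
      have h2 : (g.symm : ℂ →+* ℂ).comp θ' = (g.symm : ℂ →+* ℂ).comp θ := h.trans hθ.symm
      ext x
      have := RingHom.congr_fun h2 x
      simpa using g.symm.injective this
    exact this ▸ hθ'

/-- **Lemma B4.1's consequence (independence of the choice of `g_θ`)**: if `M̃_μ` contains the
reflex field `M_μ = ℚ(Σ_{φ ∈ Φ_μ} φ(ξ) : ξ ∈ F)` (Liu 2021 p. 41 l. 49; Shimura 1998 Prop. 28 =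
`complexTraceField`), then for two automorphisms `g, g'` of `ℂ` agreeing on `M̃_μ`,
`g⁻¹ ∘ τ₁ ∈ Φ_μ ⟺ g'⁻¹ ∘ τ₁ ∈ Φ_μ`. -/
theorem inverse_mem_iff_of_agree {M : IntermediateField ℚ ℂ} {Φμ : Finset (K →+* ℂ)}
    (hM : complexTraceField Φμ ≤ M) (τ₁ : K →+* ℂ) (g g' : ℂ ≃+* ℂ)
    (h : ∀ x : M, g x = g' x) :
    (g.symm : ℂ →+* ℂ).comp τ₁ ∈ Φμ ↔ (g'.symm : ℂ →+* ℂ).comp τ₁ ∈ Φμ := by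
  classical
  -- k := g'⁻¹ ∘ g fixes M pointwise
  set k : ℂ ≃+* ℂ := g.trans g'.symm with hk
  have hkM : ∀ x ∈ M, k x = x := by
    intro x hx
    simp only [hk, RingEquiv.trans_apply]
    have := h ⟨x, hx⟩
    simp only at this
    rw [this, RingEquiv.symm_apply_apply]
  -- k as an element of Gal(ℂ/ℚ) (a ring automorphism of ℂ is ℚ-linear)
  let k' : ℂ ≃ₐ[ℚ] ℂ := AlgEquiv.ofRingEquiv (f := k) fun q => by
    rw [eq_ratCast (algebraMap ℚ ℂ) q, map_ratCast]
  have hk' : ∀ z, k' z = k z := fun _ => rfl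
  have hfix : k' ∈ (complexTraceField Φμ).fixingSubgroup := by
    rw [IntermediateField.mem_fixingSubgroup_iff]
    intro x hx
    rw [hk']
    exact hkM x (hM hx)
  have himg : Finset.image (fun φ => ((k' : ℂ ≃ₐ[ℚ] ℂ) : ℂ →+* ℂ).comp φ) Φμ = Φμ :=
    (mem_fixingSubgroup_complexTraceField_iff Φμ k').1 hfix
  -- g'⁻¹ ∘ τ₁ = k ∘ (g⁻¹ ∘ τ₁)
  have hcomp : (g'.symm : ℂ →+* ℂ).comp τ₁ =
      ((k' : ℂ ≃ₐ[ℚ] ℂ) : ℂ →+* ℂ).comp ((g.symm : ℂ →+* ℂ).comp τ₁) := by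
    ext x
    simp [hk', hk]
  rw [hcomp]
  constructor
  · intro hmem
    rw [← himg]
    exact Finset.mem_image_of_mem _ hmem
  · intro hmem
    rw [← himg] at hmem
    obtain ⟨φ, hφ, hφeq⟩ := Finset.mem_image.1 hmem
    have hinj : Function.Injective
        (fun φ : K →+* ℂ => ((k' : ℂ ≃ₐ[ℚ] ℂ) : ℂ →+* ℂ).comp φ) := by
      intro φ₁ φ₂ h12
      ext x
      have := RingHom.congr_fun h12 x
      simpa using k'.injective this
    exact hinj hφeq ▸ hφ

/-- **TIER4 Prop. B4.3(2) = CLAIM (B4-I), the inverse type is forced.** Let `F₁ = τ₁(F) ⊆ M̃_μ`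
(the `K`-algebra structure on `M` with `(algebraMap M ℂ) ∘ (algebraMap K M) = τ₁`). Under (Eq) and
(D), `Φ̃(τ₁)` is the CM type of `M̃_μ` induced from `(F₁, Φ_μ⁻¹)`:
`θ ∈ Φ̃(τ₁) ⟺ θ|_{F₁} ∘ τ₁ ∈ Φ_μ⁻¹`, i.e. for `σ = τ₁ ∘ u ∈ Σ` ALL the embeddings `θ` above `σ` lie
in `Φ̃(τ₁)` when `σ ∈ Φ_μ⁻¹` and NONE when `σ ∉ Φ_μ⁻¹`: the `F`-type of `(A_μ ⊗_{τ₁} ℂ, ι)` is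
`r · Φ_μ⁻¹`. Proof: take `g ∈ Aut(ℂ)` extending `θ` (`exists_extension`); by `mem_iff_of_extends`,
`θ ∈ Φ̃(τ₁) ⟺ g⁻¹ ∘ τ₁ ∈ Φ_μ`, and `g⁻¹ ∘ τ₁ = τ₁ ∘ u⁻¹` when `θ|_{F₁} ∘ τ₁ = τ₁ ∘ u`
(evaluate `g⁻¹ ∘ θ = inclusion` on `τ₁(F)`). -/
theorem B4_main [NumberField K] [IsGalois ℚ K] (τ₁ : K →+* ℂ) (Φμ : Set (K →+* ℂ))
    (M : IntermediateField ℚ ℂ) [FiniteDimensional ℚ M] [Algebra K M]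
    (hτ : (algebraMap M ℂ).comp (algebraMap K M) = τ₁)
    (Φt : (K →+* ℂ) → Set (M →+* ℂ)) (hEq : EqCompat M Φt) (hD : HodgeDictionary M Φμ Φt) :
    InverseTypeForced τ₁ Φμ M Φt := by
  unfold InverseTypeForced
  ext θ
  rw [mem_inducedSet_iff]
  obtain ⟨g, hg⟩ := exists_extension M θ
  rw [mem_iff_of_extends hEq hD τ₁ θ g hg]
  obtain ⟨u, hu⟩ := (galEmb K τ₁).surjective (θ.comp (algebraMap K M))
  rw [← hu, mem_inverseType_iff]
  have h1 : (g.symm : ℂ →+* ℂ).comp (θ.comp (algebraMap K M)) = τ₁ := by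
    rw [← RingHom.comp_assoc, symm_comp_eq_algebraMap hg, hτ]
  rw [← hu, galEmb_apply] at h1
  have key : (g.symm : ℂ →+* ℂ).comp τ₁ = galEmb K τ₁ u⁻¹ := by
    rw [galEmb_apply]
    ext x
    have := RingHom.congr_fun h1 (u⁻¹ x)
    simpa using this
  rw [key]

/-- The vertex form: with `Φ_μ = T⁻¹` (the inverse type of a CM type `T` of `F` with respect to
`τ₁`), `Φ̃(τ₁)` is the CM type induced from `(F₁, T)` — «to obtain the brief's threefold of CM type
`T_i` from Liu's `A_{μ_i}` one must take `Φ_{μ_i} = T_i⁻¹`» (CLAIM (B4-I), last sentence). -/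
theorem B4_vertex [NumberField K] [IsGalois ℚ K] (τ₁ : K →+* ℂ) (T : Set (K →+* ℂ))
    (M : IntermediateField ℚ ℂ) [FiniteDimensional ℚ M] [Algebra K M]
    (hτ : (algebraMap M ℂ).comp (algebraMap K M) = τ₁)
    (Φt : (K →+* ℂ) → Set (M →+* ℂ)) (hEq : EqCompat M Φt)
    (hD : HodgeDictionary M (inverseType K τ₁ T) Φt) :
    Φt τ₁ = inducedSet T := by
  have := B4_main τ₁ (inverseType K τ₁ T) M hτ Φt hEq hD
  unfold InverseTypeForced at this
  rw [this, inverseType_inverseType]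

/-- The fibres: for `σ = τ₁ ∘ u`, every `θ` above `σ` lies in `Φ̃(τ₁)` iff `σ ∈ Φ_μ⁻¹`
(the «ALL … NONE» sentence of Prop. B4.3(2) as a statement about the fibre `Φ̃_σ`). -/
theorem fibre_subset_iff [NumberField K] [IsGalois ℚ K] (τ₁ : K →+* ℂ) (Φμ : Set (K →+* ℂ))
    (M : IntermediateField ℚ ℂ) [FiniteDimensional ℚ M] [Algebra K M]
    (hτ : (algebraMap M ℂ).comp (algebraMap K M) = τ₁)
    (Φt : (K →+* ℂ) → Set (M →+* ℂ)) (hEq : EqCompat M Φt) (hD : HodgeDictionary M Φμ Φt)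
    (σ : K →+* ℂ) (θ : M →+* ℂ) (hθ : θ ∈ fibre (L := M) σ) :
    θ ∈ Φt τ₁ ↔ σ ∈ inverseType K τ₁ Φμ := by
  have h := B4_main τ₁ Φμ M hτ Φt hEq hD
  unfold InverseTypeForced at h
  rw [h, mem_inducedSet_iff, (mem_fibre_iff σ θ).1 hθ]

open Classical in
/-- **Lemma B4.2(i) in the form B4 uses it**: if the CM type `Φ_μ = {τ₁ ∘ u : u ∈ S}` is PRIMITIVE
(`IsPrimitiveOn S`, Shimura 1998 Prop. 26 / §8.4 Ex. (1)), its reflex field is `M_μ = F₁ = τ₁(F)`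
(`traceField_eq_top_of_isPrimitiveOn` + `map_traceField`, TraceField.lean), so `M_μ ⊆ M̃_μ`
(Liu 2021 p. 41 l. 49) gives `F₁ ⊆ M̃_μ`: `τ₁` factors through `M`. -/
theorem exists_factor_of_isPrimitiveOn [NumberField K] [IsGalois ℚ K] (τ₁ : K →+* ℂ)
    (S : Finset (K ≃ₐ[ℚ] K)) (hS : IsPrimitiveOn (S : Set (K ≃ₐ[ℚ] K)))
    (M : IntermediateField ℚ ℂ) (hM : complexTraceField (S.image (galEmb K τ₁)) ≤ M) :
    ∃ ι : K →+* M, (algebraMap M ℂ).comp ι = τ₁ := by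
  have htop : traceField K S = ⊤ := traceField_eq_top_of_isPrimitiveOn S hS
  have hmem : ∀ x : K, τ₁ x ∈ M := by
    intro x
    apply hM
    rw [← map_traceField τ₁ S, htop]
    exact ⟨x, IntermediateField.mem_top, rfl⟩
  refine ⟨RingHom.codRestrict τ₁ M hmem, ?_⟩
  ext x
  rfl

open Classical in
/-- **B3 Application (i), the primitive vertices**: for a primitive `Φ_μ = {τ₁ ∘ u : u ∈ S}` with
`M_μ ⊆ M̃_μ`, under (Eq) and (D) there is an embedding `ι : F → M̃_μ` over `τ₁` (i.e. `F₁ ⊆ M̃_μ`)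
through which `Φ̃(τ₁)` is the CM type induced from `(F₁, Φ_μ⁻¹)` — Lemma B4.4's hypothesis with
`(M̃, K, T) = (M̃_μ, F₁, Φ_μ⁻¹)`. -/
theorem B4_primitive [NumberField K] [IsGalois ℚ K] (τ₁ : K →+* ℂ)
    (S : Finset (K ≃ₐ[ℚ] K)) (hS : IsPrimitiveOn (S : Set (K ≃ₐ[ℚ] K)))
    (M : IntermediateField ℚ ℂ) [FiniteDimensional ℚ M]
    (hM : complexTraceField (S.image (galEmb K τ₁)) ≤ M)
    (Φt : (K →+* ℂ) → Set (M →+* ℂ)) (hEq : EqCompat M Φt)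
    (hD : HodgeDictionary M (↑(S.image (galEmb K τ₁)) : Set (K →+* ℂ)) Φt) :
    ∃ ι : K →+* M, (algebraMap M ℂ).comp ι = τ₁ ∧
      Φt τ₁ = @inducedSet K _ M _ ι.toAlgebra (inverseType K τ₁ ↑(S.image (galEmb K τ₁))) := by
  obtain ⟨ι, hι⟩ := exists_factor_of_isPrimitiveOn τ₁ S hS M hM
  refine ⟨ι, hι, ?_⟩
  letI : Algebra K M := ι.toAlgebra
  have hτ : (algebraMap M ℂ).comp (algebraMap K M) = τ₁ := hι
  exact B4_main τ₁ _ M hτ Φt hEq hD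


/-! §8(d) (README §8, declared per file at the request of t6-ref-1, STATUS l. 4307): uses an
L-value-free non-vanishing device: NO. (v2 = v1 + this declaration; every declaration byte-identical.) -/

end Summit.Ventures.HodgeRepro2.T6.B4Main
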